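import Literature.MathematicalPhysics.QuantumFieldTheory.Balaban1983to89.T4EMLFibreAC
import Mathlib.Analysis.InnerProductSpace.PiL2
import Mathlib.Analysis.InnerProductSpace.Spectrum
import Mathlib.LinearAlgebra.FiniteDimensional.Basic
import Mathlib.Algebra.Order.BigOperators.Ring.Finset
import Mathlib.Analysis.PSeries
import HarnessLib

/-!
# T4AdResolventConvex — resolvent quadratic forms of a skew-adjoint operator on a finite-dimensional complex inner
# product space: variational lemma, Jensen inequality with slack, eigenbasis evaluation, and the pairing endgame
# (pub-balaban; map-independent CONVEXITY HALF of row T4-D.G-EML-K3-N°, offered to its producer)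

Pure finite-dimensional linear algebra over Mathlib plus the scalar function `ψ(θ) = 1 − θ cot θ` of `T4QuatExpLog` and its
Mittag-Leffler expansion `T4EMLFibreAC.hasSum_ψ`; no Bałaban content, every declaration is [folklore].  PURPOSE ONLY (no journal
text is typed here): the tangent-injectivity input `hinj` of the map-independent engines
`T4HaarUnitaryLocalDiffeo.haar_restrict_map_absolutelyContinuous_unitary` (U(N), landed) / its SU(N) companion, for the
exp-mean-log fibre map `W ↦ exp(Σ_i c_i mlog(h_i W*)) W` at general `N` (cell row T4-D.G-EML-K3-N°, an OFF-SPINE node), is being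
produced in ONE leaf by another seat; its mechanism (the general-`N` replacement of the quaternion computation of `T4EMLFibreAC`)
ends in a CONVEXITY/JENSEN step for the quadratic forms `F_x(Z) = Σ_{n≥1} 2⟪A x, (n²π² + A²)⁻¹ A x⟫`, `A = ad_Z/2` skew-adjoint for
the Hilbert–Schmidt inner product.  That step is MAP-INDEPENDENT: it only sees a skew-adjoint operator `A` on a finite-dimensional
complex inner product space `E` with `‖A v‖ ≤ r‖v‖`, `r < π`.  This file proves it once in that generality, so that the producer
instantiates `E := (M_N(ℂ), ⟪·,·⟫_HS)` (whatever `InnerProductSpace ℂ` structure it builds for Mathlib's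
`LinearMap.IsSymmetric.eigenvectorBasis`) and `A := ad_Z/2 : E →ₗ[ℂ] E`, and imports the results below instead of re-deriving them.

THE MATHEMATICS (elementary; no operator convexity, no functional calculus, no inverse API).  For skew `A` (`⟪A u, v⟫ = −⟪u, A v⟫`)
put `P_ρ(A) = ρ² + A²` (`= ρ² − A†A`), with quadratic form `Q_ρ(A, v) = Re⟪P v, v⟫ = ρ²‖v‖² − ‖A v‖² ≥ (ρ² − r²)‖v‖²` (§1); for
`0 ≤ r < ρ` it is injective, hence bijective (§2, `rsol` = the solution operator), and the RESOLVENT FORM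
`rq_ρ(A, x) = Re⟪A x, P⁻¹ A x⟫ = Q(w)` (`w = P⁻¹ A x`) satisfies the VARIATIONAL LEMMA
`rq_ρ(A, x) − L_ρ(A; A x, v) = Q(w − v) ≥ 0`, `L_ρ(A; u, v) = 2 Re⟪u, v⟫ − ρ²‖v‖² + ‖A v‖²` (`lag_le_rq`, `lag_rsol`), and
`0 ≤ rq ≤ ‖A x‖²/(ρ² − r²)` (§2).  The DEFECT FORM `F(A, x) = Σ_{n≥0} 2 rq_{(n+1)π}(A, x)` converges for `r < π` (§3).  JENSEN WITH
SLACK (§4, `rq_sum_smul_le`, `defect_sum_smul_le`): for skew `r`-bounded `A_i`, `c_i ≥ 0`, `Σ c_i ≤ 1`,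
`F(Σ c_i A_i, x) ≤ Σ c_i F(A_i, x)` — evaluate every Lagrangian at the maximiser `w` of the combination and use
`‖Σ c_i A_i w‖² ≤ Σ c_i ‖A_i w‖²` (two-line Cauchy–Schwarz) and `−ρ²‖w‖² ≤ −(Σ c_i)ρ²‖w‖²`; the slack `1 − Σ c_i` is absorbed
without padding the combination with the point `0`.  EIGEN-EVALUATION (§5): if `b` is an orthonormal basis with `A b_α = iμ_α b_α`
(`μ_α` real, automatically `|μ_α| ≤ r`), then `rq_ρ(A, x) = Σ_α |⟪b_α, x⟫|² μ_α²/(ρ² − μ_α²)` and, by Mittag-Leffler,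
`F(A, x) = Σ_α |⟪b_α, x⟫|² ψ(μ_α)` (`defect_eq_sum_eigen`); consequently (`re_inner_eq_norm_sq_sub_defect`) any vector `H` whose
`b`-coordinates are `m_α ⟪b_α, x⟫` with `Re m_α = 1 − ψ(μ_α)` (the shape of the KEY IDENTITY of the producer's leaf:
`Re g(2iμ) = μ cot μ = 1 − ψ(μ)` for `g(u) = u/(1 − e^{−u})`) has `Re⟪x, H⟫ = ‖x‖² − F(A, x)`.  ENDGAME (§6,
`eq_zero_of_kernel_equation`): if `Re⟪x, H_i⟫ = ‖x‖² − F(A_i, x)`, `Re⟪x, H₀⟫ = ‖x‖² − F(Σ c_i A_i, x)` and `Σ c_i H_i = H₀` with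
`Σ c_i < 1`, then `(1 − Σ c_i)‖x‖² = F(Σ c_i A_i, x) − Σ c_i F(A_i, x) ≤ 0`, so `x = 0`.  Only `Σ c_i < 1` is used — no smallness.

CONTENT.
* §1 `IsSkew`, `P`, `re_inner_P`, `Q`, `Q_coercive`, `Q_sub` (polarisation), `lag`.
* §2 `IsBdd`, `P_injective`, `rsol`, `P_rsol`, `rq`, `rq_eq_Q`, `rq_sub_lag_eq`, `lag_le_rq`, `lag_rsol`, `rq_nonneg`, `rq_le`,
  `rq_zero`.
* §3 `term`, `defect`, `defect_zero_op`, `term_nonneg`, `term_le`, `summable_term`, `hasSum_defect`, `defect_nonneg`.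
* §4 `isSkew_sum_smul`, `norm_sum_smul_sq_le` (Cauchy–Schwarz), `isBdd_sum_smul`, `rq_sum_smul_le`, `defect_sum_smul_le` (JENSEN).
* §5 `isSymmetric_negI_smul`, `exists_orthonormalBasis_eigen` (spectral theorem for skew `A`), `abs_eig_le`, `apply_eq_sum_eigen`, `P_apply_eigen`, `rsol_eq_sum_eigen`, `rq_eq_sum_eigen`, `ψ_neg`, `hasSum_ψ_of_abs_lt`,
  `defect_eq_sum_eigen`, `re_inner_of_diag_coords`, `re_inner_eq_norm_sq_sub_defect`.
* §6 `eq_zero_of_kernel_equation` (ENDGAME).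

INTERFACE NOTES for the consumer.  Operators are `E →ₗ[ℂ] E`; the bound is the operator-norm-free `IsBdd A r : ∀ v, ‖A v‖ ≤ r‖v‖`
(for `A = ad_Z/2` on Hilbert–Schmidt space take `r = ‖Z‖_op`, from `‖Z v − v Z‖_HS ≤ 2‖Z‖_op ‖v‖_HS`); convex combinations are
`Σ_i ((c_i : ℝ) : ℂ) • A_i` over a `Fintype` (so `ad_{Σ c_i Z_i}/2 = Σ_i (c_i : ℂ) • ad_{Z_i}/2` is the only rewrite the consumer
supplies); eigen-data enter as `hb : ∀ α, A (b α) = ((μ α : ℂ) * I) • b α` with `b : OrthonormalBasis ι ℂ E`, `μ : ι → ℝ` — the output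
shape of `LinearMap.IsSymmetric.eigenvectorBasis` for the symmetric operator `−I • A` (eigenvalues `μ`).

VALUE = kernel linear algebra serving a named OFF-SPINE node (it changes no count); NOT an estimate of the papers, NOT summit
progress.  Nothing printed is asserted or cited.
-/

noncomputable section

open scoped ComplexInnerProductSpace ComplexConjugate
open Function

namespace Literature.MathematicalPhysics.QuantumFieldTheory.Balaban1983to89.T4AdResolventConvex

variable {E : Type*} [NormedAddCommGroup E] [InnerProductSpace ℂ E]

/-! ## 1. Skew-adjoint operators and the operator `P_ρ(A) = ρ² + A²` -/

/-- `A` is skew-adjoint: `⟪A u, v⟫ = −⟪u, A v⟫`. [folklore] -/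
def IsSkew (A : E →ₗ[ℂ] E) : Prop := ∀ u v : E, ⟪A u, v⟫ = -⟪u, A v⟫

/-- `P_ρ(A) = ρ²·id + A ∘ A` (for skew `A` this is `ρ² − A†A`). [folklore] -/
def P (ρ : ℝ) (A : E →ₗ[ℂ] E) : E →ₗ[ℂ] E := ((ρ : ℂ) ^ 2) • LinearMap.id + A ∘ₗ A

/-- `P_ρ(A) v = ρ² v + A (A v)`. [folklore] -/
theorem P_apply (ρ : ℝ) (A : E →ₗ[ℂ] E) (v : E) : P ρ A v = ((ρ : ℂ) ^ 2) • v + A (A v) := rfl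

/-- For skew `A`: `⟪A (A u), v⟫ = −⟪A u, A v⟫`. [folklore] -/
theorem inner_AA_left {A : E →ₗ[ℂ] E} (hA : IsSkew A) (u v : E) : ⟪A (A u), v⟫ = -⟪A u, A v⟫ := hA (A u) v

/-- For skew `A`: `⟪u, A (A v)⟫ = −⟪A u, A v⟫`. [folklore] -/
theorem inner_AA_right {A : E →ₗ[ℂ] E} (hA : IsSkew A) (u v : E) : ⟪u, A (A v)⟫ = -⟪A u, A v⟫ := by
  have h := hA u (A v)
  rw [h, neg_neg]

/-- `P_ρ(A)` is symmetric for skew `A`. [folklore] -/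
theorem inner_P_comm {A : E →ₗ[ℂ] E} (hA : IsSkew A) (ρ : ℝ) (u v : E) : ⟪P ρ A u, v⟫ = ⟪u, P ρ A v⟫ := by
  simp only [P_apply, inner_add_left, inner_add_right, inner_smul_left, inner_smul_right, inner_AA_left hA,
    inner_AA_right hA]
  congr 1
  rw [show ((ρ : ℂ) ^ 2) = ((ρ ^ 2 : ℝ) : ℂ) by push_cast; ring, Complex.conj_ofReal]


/-- The quadratic form of `P_ρ(A)` for skew `A`: `Re⟪P v, v⟫ = ρ²‖v‖² − ‖A v‖²`. [folklore] -/
theorem re_inner_P {A : E →ₗ[ℂ] E} (hA : IsSkew A) (ρ : ℝ) (v : E) :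
    (⟪P ρ A v, v⟫).re = ρ ^ 2 * ‖v‖ ^ 2 - ‖A v‖ ^ 2 := by
  rw [P_apply, inner_add_left, inner_AA_left hA, inner_smul_left, Complex.add_re, Complex.neg_re,
    show ((ρ : ℂ) ^ 2) = ((ρ ^ 2 : ℝ) : ℂ) by push_cast; ring, Complex.conj_ofReal, Complex.re_ofReal_mul]
  have h1 : (⟪v, v⟫).re = ‖v‖ ^ 2 := by
    have := inner_self_eq_norm_sq (𝕜 := ℂ) v
    simpa using this
  have h2 : (⟪A v, A v⟫).re = ‖A v‖ ^ 2 := by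
    have := inner_self_eq_norm_sq (𝕜 := ℂ) (A v)
    simpa using this
  rw [h1, h2]; ring

/-- The quadratic form `Q_ρ(A, v) = ρ²‖v‖² − ‖A v‖²`. [folklore] -/
def Q (ρ : ℝ) (A : E →ₗ[ℂ] E) (v : E) : ℝ := ρ ^ 2 * ‖v‖ ^ 2 - ‖A v‖ ^ 2

/-- `Q_ρ(A, v) = Re⟪P_ρ(A) v, v⟫` for skew `A`. [folklore] -/
theorem Q_eq_re_inner_P {A : E →ₗ[ℂ] E} (hA : IsSkew A) (ρ : ℝ) (v : E) : Q ρ A v = (⟪P ρ A v, v⟫).re := by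
  rw [re_inner_P hA]; rfl

/-- Coercivity of `Q` under the bound `‖A v‖ ≤ r‖v‖`: `(ρ² − r²)‖v‖² ≤ Q_ρ(A, v)`. [folklore] -/
theorem Q_coercive {A : E →ₗ[ℂ] E} {r : ℝ} (hr : ∀ v, ‖A v‖ ≤ r * ‖v‖) (ρ : ℝ) (v : E) :
    (ρ ^ 2 - r ^ 2) * ‖v‖ ^ 2 ≤ Q ρ A v := by
  have h1 : ‖A v‖ ^ 2 ≤ (r * ‖v‖) ^ 2 := pow_le_pow_left₀ (norm_nonneg _) (hr v) 2
  unfold Q; nlinarith [h1]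

/-- Polarisation of `Q`: `Q(w − v) = Q(w) − 2 Re⟪P w, v⟫ + Q(v)` (uses the symmetry of `P`). [folklore] -/
theorem Q_sub {A : E →ₗ[ℂ] E} (hA : IsSkew A) (ρ : ℝ) (w v : E) :
    Q ρ A (w - v) = Q ρ A w - 2 * (⟪P ρ A w, v⟫).re + Q ρ A v := by
  rw [Q_eq_re_inner_P hA, Q_eq_re_inner_P hA, Q_eq_re_inner_P hA, map_sub, inner_sub_left, inner_sub_right,
    inner_sub_right]
  have hs : (⟪P ρ A v, w⟫).re = (⟪P ρ A w, v⟫).re := by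
    rw [inner_P_comm hA, ← inner_conj_symm, Complex.conj_re]
  simp only [Complex.sub_re]
  rw [hs]; ring

/-- THE LAGRANGIAN `L_ρ(A; u, v) = 2 Re⟪u, v⟫ − ρ²‖v‖² + ‖A v‖² = 2 Re⟪u, v⟫ − Q_ρ(A, v)`. [folklore] -/
def lag (ρ : ℝ) (A : E →ₗ[ℂ] E) (u v : E) : ℝ := 2 * (⟪u, v⟫).re - ρ ^ 2 * ‖v‖ ^ 2 + ‖A v‖ ^ 2

/-- `L = 2 Re⟪u, v⟫ − Q(v)`. [folklore] -/
theorem lag_eq (ρ : ℝ) (A : E →ₗ[ℂ] E) (u v : E) : lag ρ A u v = 2 * (⟪u, v⟫).re - Q ρ A v := by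
  unfold lag Q; ring

/-! ## 2. The bound `‖A v‖ ≤ r‖v‖`, injectivity of `P`, the solution operator and the resolvent form -/

/-- `A` is `r`-bounded: `‖A v‖ ≤ r ‖v‖` for all `v` (an operator-norm bound stated without operator norms). [folklore] -/
def IsBdd (A : E →ₗ[ℂ] E) (r : ℝ) : Prop := ∀ v : E, ‖A v‖ ≤ r * ‖v‖

/-- `P_ρ(A)` is injective for skew `r`-bounded `A`, `0 ≤ r < ρ`. [folklore] -/
theorem P_injective {A : E →ₗ[ℂ] E} (hA : IsSkew A) {r ρ : ℝ} (hr : IsBdd A r) (hr0 : 0 ≤ r) (hrρ : r < ρ) :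
    Injective (P ρ A) := by
  intro v w hvw
  have h0 : P ρ A (v - w) = 0 := by rw [map_sub, hvw, sub_self]
  have hQ : Q ρ A (v - w) = 0 := by rw [Q_eq_re_inner_P hA, h0, inner_zero_left, Complex.zero_re]
  have hc := Q_coercive hr ρ (v - w)
  have hpos : 0 < ρ ^ 2 - r ^ 2 := by nlinarith
  have : ‖v - w‖ ^ 2 ≤ 0 := by
    by_contra h
    push Not at h
    have := mul_pos hpos h
    linarith
  have : ‖v - w‖ = 0 := by nlinarith [norm_nonneg (v - w)]
  exact sub_eq_zero.1 (norm_eq_zero.1 this)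

variable [FiniteDimensional ℂ E]

/-- THE SOLUTION OPERATOR: `rsol ρ A u` is the unique `w` with `P_ρ(A) w = u` when `P_ρ(A)` is injective (hence
bijective, `E` being finite-dimensional), and `0` otherwise. [folklore] -/
def rsol (ρ : ℝ) (A : E →ₗ[ℂ] E) (u : E) : E := by
  classical
  exact if h : Injective (P ρ A) then (LinearEquiv.ofInjectiveEndo (P ρ A) h).symm u else 0

/-- `P (rsol u) = u` when `P` is injective. [folklore] -/
theorem P_rsol {ρ : ℝ} {A : E →ₗ[ℂ] E} (h : Injective (P ρ A)) (u : E) : P ρ A (rsol ρ A u) = u := by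
  classical
  unfold rsol; rw [dif_pos h]
  exact (LinearEquiv.ofInjectiveEndo (P ρ A) h).apply_symm_apply u

/-- Uniqueness: `P w = u` ⟹ `rsol u = w`. [folklore] -/
theorem rsol_eq_of_P_eq {ρ : ℝ} {A : E →ₗ[ℂ] E} (h : Injective (P ρ A)) {u w : E} (hw : P ρ A w = u) :
    rsol ρ A u = w :=
  h (by rw [P_rsol h, hw])

/-- `rsol` is additive (when `P` is injective). [folklore] -/
theorem rsol_add {ρ : ℝ} {A : E →ₗ[ℂ] E} (h : Injective (P ρ A)) (u u' : E) :
    rsol ρ A (u + u') = rsol ρ A u + rsol ρ A u' :=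
  rsol_eq_of_P_eq h (by rw [map_add, P_rsol h, P_rsol h])

/-- `rsol` is homogeneous (when `P` is injective). [folklore] -/
theorem rsol_smul {ρ : ℝ} {A : E →ₗ[ℂ] E} (h : Injective (P ρ A)) (c : ℂ) (u : E) :
    rsol ρ A (c • u) = c • rsol ρ A u :=
  rsol_eq_of_P_eq h (by rw [map_smul, P_rsol h])

/-- THE RESOLVENT FORM `rq_ρ(A, x) = Re⟪A x, P_ρ(A)⁻¹ (A x)⟫` (`= ⟪A x, (ρ² + A²)⁻¹ A x⟫`; junk value when `P` is not
injective). [folklore] -/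
def rq (ρ : ℝ) (A : E →ₗ[ℂ] E) (x : E) : ℝ := (⟪A x, rsol ρ A (A x)⟫).re

/-- `rq = Q(w)` at the solution `w = rsol (A x)`. [folklore] -/
theorem rq_eq_Q {ρ : ℝ} {A : E →ₗ[ℂ] E} (hA : IsSkew A) (h : Injective (P ρ A)) (x : E) :
    rq ρ A x = Q ρ A (rsol ρ A (A x)) := by
  rw [Q_eq_re_inner_P hA, P_rsol h]; rfl

/-- THE VARIATIONAL LEMMA: `L_ρ(A; A x, v) ≤ rq_ρ(A, x)` for every `v`, with the explicit deficit
`rq − L = Q(w − v) ≥ (ρ² − r²)‖w − v‖²`. [folklore] -/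
theorem rq_sub_lag_eq {ρ : ℝ} {A : E →ₗ[ℂ] E} (hA : IsSkew A) (h : Injective (P ρ A)) (x v : E) :
    rq ρ A x - lag ρ A (A x) v = Q ρ A (rsol ρ A (A x) - v) := by
  rw [Q_sub hA, P_rsol h, lag_eq, rq_eq_Q hA h]; ring

/-- THE VARIATIONAL INEQUALITY `L_ρ(A; A x, v) ≤ rq_ρ(A, x)` for skew `r`-bounded `A`, `0 ≤ r < ρ`. [folklore] -/
theorem lag_le_rq {A : E →ₗ[ℂ] E} (hA : IsSkew A) {r ρ : ℝ} (hr : IsBdd A r) (hr0 : 0 ≤ r) (hrρ : r < ρ)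
    (x v : E) : lag ρ A (A x) v ≤ rq ρ A x := by
  have h := P_injective hA hr hr0 hrρ
  have h1 := rq_sub_lag_eq hA h x v (ρ := ρ)
  have h2 := Q_coercive hr ρ (rsol ρ A (A x) - v)
  have hpos : 0 ≤ ρ ^ 2 - r ^ 2 := by nlinarith
  nlinarith [mul_nonneg hpos (sq_nonneg ‖rsol ρ A (A x) - v‖)]

/-- Equality in the variational lemma at `v = rsol (A x)`. [folklore] -/
theorem lag_rsol {ρ : ℝ} {A : E →ₗ[ℂ] E} (hA : IsSkew A) (h : Injective (P ρ A)) (x : E) :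
    lag ρ A (A x) (rsol ρ A (A x)) = rq ρ A x := by
  have h1 := rq_sub_lag_eq hA h x (rsol ρ A (A x)) (ρ := ρ)
  rw [sub_self] at h1
  have : Q ρ A (0 : E) = 0 := by simp [Q]
  linarith [h1, this]

/-- `0 ≤ rq`, indeed `(ρ² − r²)‖w‖² ≤ rq`. [folklore] -/
theorem rq_nonneg {A : E →ₗ[ℂ] E} (hA : IsSkew A) {r ρ : ℝ} (hr : IsBdd A r) (hr0 : 0 ≤ r) (hrρ : r < ρ) (x : E) :
    0 ≤ rq ρ A x := by
  have h := P_injective hA hr hr0 hrρ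
  rw [rq_eq_Q hA h]
  have h2 := Q_coercive hr ρ (rsol ρ A (A x))
  have hpos : 0 ≤ ρ ^ 2 - r ^ 2 := by nlinarith
  nlinarith [mul_nonneg hpos (sq_nonneg ‖rsol ρ A (A x)‖)]

/-- The a-priori bound `rq_ρ(A, x) ≤ ‖A x‖²/(ρ² − r²)`. [folklore] -/
theorem rq_le {A : E →ₗ[ℂ] E} (hA : IsSkew A) {r ρ : ℝ} (hr : IsBdd A r) (hr0 : 0 ≤ r) (hrρ : r < ρ) (x : E) :
    rq ρ A x ≤ ‖A x‖ ^ 2 / (ρ ^ 2 - r ^ 2) := by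
  have h := P_injective hA hr hr0 hrρ
  set w := rsol ρ A (A x) with hw
  have hpos : 0 < ρ ^ 2 - r ^ 2 := by nlinarith
  have hQ : rq ρ A x = Q ρ A w := rq_eq_Q hA h x
  have hc := Q_coercive hr ρ w
  -- `rq = Re⟪A x, w⟫ ≤ ‖A x‖‖w‖`
  have hcs : rq ρ A x ≤ ‖A x‖ * ‖w‖ := by
    unfold rq
    exact (Complex.re_le_norm _).trans (norm_inner_le_norm _ _)
  -- hence `(ρ² − r²)‖w‖ ≤ ‖A x‖`
  have hw1 : (ρ ^ 2 - r ^ 2) * ‖w‖ ≤ ‖A x‖ := by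
    by_cases hw0 : ‖w‖ = 0
    · rw [hw0, mul_zero]; exact norm_nonneg _
    · have hwp : 0 < ‖w‖ := lt_of_le_of_ne (norm_nonneg _) (Ne.symm hw0)
      have : (ρ ^ 2 - r ^ 2) * ‖w‖ ^ 2 ≤ ‖A x‖ * ‖w‖ := hc.trans (hQ ▸ hcs)
      nlinarith
  rw [le_div_iff₀ hpos]
  calc rq ρ A x * (ρ ^ 2 - r ^ 2) ≤ ‖A x‖ * ‖w‖ * (ρ ^ 2 - r ^ 2) := by nlinarith
    _ = ‖A x‖ * ((ρ ^ 2 - r ^ 2) * ‖w‖) := by ring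
    _ ≤ ‖A x‖ * ‖A x‖ := by gcongr
    _ = ‖A x‖ ^ 2 := by ring

/-- At `A = 0` the resolvent form vanishes. [folklore] -/
@[simp] theorem rq_zero (ρ : ℝ) (x : E) : rq ρ (0 : E →ₗ[ℂ] E) x = 0 := by
  simp [rq]


/-! ## 3. The defect series `F(A, x) = Σ_{n ≥ 1} 2 rq_{nπ}(A, x)` -/

/-- The `n`-th term `2·rq_{(n+1)π}(A, x)`. [folklore] -/
def term (A : E →ₗ[ℂ] E) (x : E) (n : ℕ) : ℝ := 2 * rq (((n : ℝ) + 1) * Real.pi) A x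

/-- THE DEFECT FORM `F(A, x) = Σ_{n ≥ 0} 2 rq_{(n+1)π}(A, x)` (`= Σ_{n≥1} 2⟪A x, (n²π² + A²)⁻¹ A x⟫`). [folklore] -/
def defect (A : E →ₗ[ℂ] E) (x : E) : ℝ := ∑' n : ℕ, term A x n

/-- The terms vanish at `A = 0`. [folklore] -/
@[simp] theorem term_zero_op (x : E) (n : ℕ) : term (0 : E →ₗ[ℂ] E) x n = 0 := by simp [term]

/-- `F(0, x) = 0`. [folklore] -/
@[simp] theorem defect_zero_op (x : E) : defect (0 : E →ₗ[ℂ] E) x = 0 := by simp [defect]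

/-- `r < π ≤ (n+1)π`. [folklore] -/
theorem lt_succ_mul_pi {r : ℝ} (hrπ : r < Real.pi) (n : ℕ) : r < ((n : ℝ) + 1) * Real.pi := by
  have hn : (1 : ℝ) ≤ (n : ℝ) + 1 := by
    have : (0 : ℝ) ≤ n := Nat.cast_nonneg n
    linarith
  nlinarith [Real.pi_pos]

/-- `0 ≤ term`. [folklore] -/
theorem term_nonneg {A : E →ₗ[ℂ] E} (hA : IsSkew A) {r : ℝ} (hr : IsBdd A r) (hr0 : 0 ≤ r) (hrπ : r < Real.pi)
    (x : E) (n : ℕ) : 0 ≤ term A x n := by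
  unfold term
  exact mul_nonneg zero_le_two (rq_nonneg hA hr hr0 (lt_succ_mul_pi hrπ n) x)

/-- The comparison bound `term ≤ (2‖A x‖²/(π² − r²))·(n+1)⁻²`. [folklore] -/
theorem term_le {A : E →ₗ[ℂ] E} (hA : IsSkew A) {r : ℝ} (hr : IsBdd A r) (hr0 : 0 ≤ r) (hrπ : r < Real.pi)
    (x : E) (n : ℕ) : term A x n ≤ 2 * ‖A x‖ ^ 2 / (Real.pi ^ 2 - r ^ 2) * (1 / ((n : ℝ) + 1) ^ 2) := by
  have hρ := lt_succ_mul_pi hrπ n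
  have h1 := rq_le hA hr hr0 hρ x
  have hpos : 0 < Real.pi ^ 2 - r ^ 2 := by nlinarith [Real.pi_pos]
  have hn : (1 : ℝ) ≤ ((n : ℝ) + 1) ^ 2 := by
    have : (0 : ℝ) ≤ n := Nat.cast_nonneg n
    nlinarith
  -- `((n+1)π)² − r² ≥ (n+1)²(π² − r²)`
  have hden : ((n : ℝ) + 1) ^ 2 * (Real.pi ^ 2 - r ^ 2) ≤ (((n : ℝ) + 1) * Real.pi) ^ 2 - r ^ 2 := by
    nlinarith [sq_nonneg r]
  have hden_pos : 0 < ((n : ℝ) + 1) ^ 2 * (Real.pi ^ 2 - r ^ 2) := by positivity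
  unfold term
  calc 2 * rq (((n : ℝ) + 1) * Real.pi) A x ≤ 2 * (‖A x‖ ^ 2 / ((((n : ℝ) + 1) * Real.pi) ^ 2 - r ^ 2)) := by
        linarith
    _ ≤ 2 * (‖A x‖ ^ 2 / (((n : ℝ) + 1) ^ 2 * (Real.pi ^ 2 - r ^ 2))) := by
        gcongr
    _ = 2 * ‖A x‖ ^ 2 / (Real.pi ^ 2 - r ^ 2) * (1 / ((n : ℝ) + 1) ^ 2) := by
        field_simp

/-- SUMMABILITY of the defect series for skew `r`-bounded `A`, `r < π`. [folklore] -/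
theorem summable_term {A : E →ₗ[ℂ] E} (hA : IsSkew A) {r : ℝ} (hr : IsBdd A r) (hr0 : 0 ≤ r) (hrπ : r < Real.pi)
    (x : E) : Summable (term A x) := by
  have hg : Summable (fun n : ℕ => 2 * ‖A x‖ ^ 2 / (Real.pi ^ 2 - r ^ 2) * (1 / ((n : ℝ) + 1) ^ 2)) := by
    apply Summable.mul_left
    have h := (summable_nat_add_iff 1).2 (Real.summable_one_div_nat_pow.2 one_lt_two)
    simpa [Nat.cast_add, Nat.cast_one] using h
  exact Summable.of_nonneg_of_le (term_nonneg hA hr hr0 hrπ x) (term_le hA hr hr0 hrπ x) hg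

/-- `HasSum term (defect A x)`. [folklore] -/
theorem hasSum_defect {A : E →ₗ[ℂ] E} (hA : IsSkew A) {r : ℝ} (hr : IsBdd A r) (hr0 : 0 ≤ r) (hrπ : r < Real.pi)
    (x : E) : HasSum (term A x) (defect A x) :=
  (summable_term hA hr hr0 hrπ x).hasSum

/-- `0 ≤ F(A, x)`. [folklore] -/
theorem defect_nonneg {A : E →ₗ[ℂ] E} (hA : IsSkew A) {r : ℝ} (hr : IsBdd A r) (hr0 : 0 ≤ r) (hrπ : r < Real.pi)
    (x : E) : 0 ≤ defect A x :=
  tsum_nonneg (term_nonneg hA hr hr0 hrπ x)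

/-! ## 4. Jensen's inequality with slack for convex combinations of total weight `≤ 1` -/

section Jensen

variable {ι : Type*} [Fintype ι]

omit [FiniteDimensional ℂ E] in
/-- Skewness is preserved by real convex (indeed any real-linear) combinations. [folklore] -/
theorem isSkew_sum_smul {A : ι → E →ₗ[ℂ] E} (hA : ∀ i, IsSkew (A i)) (c : ι → ℝ) :
    IsSkew (∑ i, ((c i : ℝ) : ℂ) • A i) := by
  intro u v
  simp only [LinearMap.coe_sum, Finset.sum_apply, LinearMap.smul_apply, sum_inner, inner_sum, inner_smul_left,
    inner_smul_right, Complex.conj_ofReal, hA _ u v, mul_neg, Finset.sum_neg_distrib]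

omit [FiniteDimensional ℂ E] in
/-- Pointwise evaluation of `Σ c_i A_i`. [folklore] -/
theorem sum_smul_apply (A : ι → E →ₗ[ℂ] E) (c : ι → ℝ) (v : E) :
    (∑ i, ((c i : ℝ) : ℂ) • A i) v = ∑ i, ((c i : ℝ) : ℂ) • A i v := by
  simp [LinearMap.coe_sum, Finset.sum_apply]

omit [FiniteDimensional ℂ E] [InnerProductSpace ℂ E] in
/-- `‖Σ c_i y_i‖ ≤ Σ c_i ‖y_i‖` for `c_i ≥ 0`. [folklore] -/
theorem norm_sum_smul_le [NormedSpace ℂ E] (c : ι → ℝ) (hc : ∀ i, 0 ≤ c i) (y : ι → E) :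
    ‖∑ i, ((c i : ℝ) : ℂ) • y i‖ ≤ ∑ i, c i * ‖y i‖ := by
  refine (norm_sum_le _ _).trans (le_of_eq ?_)
  refine Finset.sum_congr rfl fun i _ => ?_
  rw [norm_smul, Complex.norm_real, Real.norm_of_nonneg (hc i)]

omit [FiniteDimensional ℂ E] [InnerProductSpace ℂ E] in
/-- TWO-LINE CAUCHY–SCHWARZ: `‖Σ c_i y_i‖² ≤ (Σ c_i)·Σ c_i‖y_i‖²` for `c_i ≥ 0`. [folklore] -/
theorem norm_sum_smul_sq_le [NormedSpace ℂ E] (c : ι → ℝ) (hc : ∀ i, 0 ≤ c i) (y : ι → E) :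
    ‖∑ i, ((c i : ℝ) : ℂ) • y i‖ ^ 2 ≤ (∑ i, c i) * ∑ i, c i * ‖y i‖ ^ 2 := by
  have h1 := norm_sum_smul_le c hc y
  have h2 : (∑ i, c i * ‖y i‖) ^ 2 ≤ (∑ i, c i) * ∑ i, c i * ‖y i‖ ^ 2 := by
    have h := Finset.sum_mul_sq_le_sq_mul_sq Finset.univ (fun i => Real.sqrt (c i)) (fun i => Real.sqrt (c i) * ‖y i‖)
    have e1 : ∀ i, Real.sqrt (c i) * (Real.sqrt (c i) * ‖y i‖) = c i * ‖y i‖ := fun i => by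
      rw [← mul_assoc, Real.mul_self_sqrt (hc i)]
    have e2 : ∀ i, Real.sqrt (c i) ^ 2 = c i := fun i => Real.sq_sqrt (hc i)
    have e3 : ∀ i, (Real.sqrt (c i) * ‖y i‖) ^ 2 = c i * ‖y i‖ ^ 2 := fun i => by
      rw [mul_pow, Real.sq_sqrt (hc i)]
    simpa only [e1, e2, e3] using h
  calc ‖∑ i, ((c i : ℝ) : ℂ) • y i‖ ^ 2 ≤ (∑ i, c i * ‖y i‖) ^ 2 :=
        pow_le_pow_left₀ (norm_nonneg _) h1 2
    _ ≤ _ := h2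

omit [FiniteDimensional ℂ E] [InnerProductSpace ℂ E] in
/-- With total weight `Σ c_i ≤ 1`: `‖Σ c_i y_i‖² ≤ Σ c_i‖y_i‖²`. [folklore] -/
theorem norm_sum_smul_sq_le' [NormedSpace ℂ E] (c : ι → ℝ) (hc : ∀ i, 0 ≤ c i) (hcs : ∑ i, c i ≤ 1) (y : ι → E) :
    ‖∑ i, ((c i : ℝ) : ℂ) • y i‖ ^ 2 ≤ ∑ i, c i * ‖y i‖ ^ 2 := by
  have h := norm_sum_smul_sq_le c hc y
  have hS : 0 ≤ ∑ i, c i * ‖y i‖ ^ 2 := Finset.sum_nonneg fun i _ => mul_nonneg (hc i) (sq_nonneg _)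
  nlinarith

omit [FiniteDimensional ℂ E] in
/-- The `r`-bound is preserved by convex combinations of total weight `≤ 1`. [folklore] -/
theorem isBdd_sum_smul {A : ι → E →ₗ[ℂ] E} {r : ℝ} (hr : ∀ i, IsBdd (A i) r) (hr0 : 0 ≤ r) (c : ι → ℝ)
    (hc : ∀ i, 0 ≤ c i) (hcs : ∑ i, c i ≤ 1) : IsBdd (∑ i, ((c i : ℝ) : ℂ) • A i) r := by
  intro v
  rw [sum_smul_apply]
  refine (norm_sum_smul_le c hc _).trans ?_
  calc ∑ i, c i * ‖A i v‖ ≤ ∑ i, c i * (r * ‖v‖) :=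
        Finset.sum_le_sum fun i _ => mul_le_mul_of_nonneg_left (hr i v) (hc i)
    _ = (∑ i, c i) * (r * ‖v‖) := by rw [Finset.sum_mul]
    _ ≤ 1 * (r * ‖v‖) := by gcongr
    _ = r * ‖v‖ := one_mul _

/-- JENSEN WITH SLACK for the resolvent form: `A_i` skew and `r`-bounded, `0 ≤ r < ρ`, `c_i ≥ 0`, `Σ c_i ≤ 1` ⟹
`rq_ρ(Σ c_i A_i, x) ≤ Σ c_i rq_ρ(A_i, x)`.  Proof: evaluate the Lagrangians at the maximiser `w` of the combination and use
`‖Σ c_i A_i w‖² ≤ Σ c_i ‖A_i w‖²`, `−ρ²‖w‖² ≤ −(Σ c_i) ρ²‖w‖²`; no convexity API. [folklore] -/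
theorem rq_sum_smul_le {A : ι → E →ₗ[ℂ] E} (hA : ∀ i, IsSkew (A i)) {r ρ : ℝ} (hr : ∀ i, IsBdd (A i) r)
    (hr0 : 0 ≤ r) (hrρ : r < ρ) (c : ι → ℝ) (hc : ∀ i, 0 ≤ c i) (hcs : ∑ i, c i ≤ 1) (x : E) :
    rq ρ (∑ i, ((c i : ℝ) : ℂ) • A i) x ≤ ∑ i, c i * rq ρ (A i) x := by
  set A₀ : E →ₗ[ℂ] E := ∑ i, ((c i : ℝ) : ℂ) • A i with hA₀
  have hA₀s : IsSkew A₀ := isSkew_sum_smul hA c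
  have hA₀b : IsBdd A₀ r := isBdd_sum_smul hr hr0 c hc hcs
  have hinj : Injective (P ρ A₀) := P_injective hA₀s hA₀b hr0 hrρ
  set w := rsol ρ A₀ (A₀ x) with hw
  -- `rq(A₀) = L(A₀; A₀ x, w)`
  rw [← lag_rsol hA₀s hinj x, ← hw]
  -- the three pieces of the Lagrangian
  have h1 : 2 * (⟪A₀ x, w⟫).re = ∑ i, c i * (2 * (⟪A i x, w⟫).re) := by
    rw [hA₀, sum_smul_apply, sum_inner]
    simp only [inner_smul_left, Complex.conj_ofReal, Complex.re_sum, Complex.re_ofReal_mul, Finset.mul_sum]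
    refine Finset.sum_congr rfl fun i _ => by ring
  have h2 : ‖A₀ w‖ ^ 2 ≤ ∑ i, c i * ‖A i w‖ ^ 2 := by
    rw [hA₀, sum_smul_apply]; exact norm_sum_smul_sq_le' c hc hcs _
  have h3 : -(ρ ^ 2 * ‖w‖ ^ 2) ≤ ∑ i, c i * (-(ρ ^ 2 * ‖w‖ ^ 2)) := by
    rw [← Finset.sum_mul]
    have : 0 ≤ ρ ^ 2 * ‖w‖ ^ 2 := by positivity
    nlinarith
  -- each Lagrangian is below its own `rq`
  have h4 : ∀ i, lag ρ (A i) (A i x) w ≤ rq ρ (A i) x := fun i => lag_le_rq (hA i) (hr i) hr0 hrρ x w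
  calc lag ρ A₀ (A₀ x) w = 2 * (⟪A₀ x, w⟫).re + -(ρ ^ 2 * ‖w‖ ^ 2) + ‖A₀ w‖ ^ 2 := by unfold lag; ring
    _ ≤ ∑ i, c i * (2 * (⟪A i x, w⟫).re) + ∑ i, c i * (-(ρ ^ 2 * ‖w‖ ^ 2)) + ∑ i, c i * ‖A i w‖ ^ 2 := by
        rw [h1]; gcongr
    _ = ∑ i, c i * lag ρ (A i) (A i x) w := by
        rw [← Finset.sum_add_distrib, ← Finset.sum_add_distrib]
        refine Finset.sum_congr rfl fun i _ => ?_
        unfold lag; ring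
    _ ≤ ∑ i, c i * rq ρ (A i) x := Finset.sum_le_sum fun i _ => mul_le_mul_of_nonneg_left (h4 i) (hc i)

/-- JENSEN WITH SLACK for the defect form: `F(Σ c_i A_i, x) ≤ Σ c_i F(A_i, x)` (`A_i` skew, `r`-bounded, `0 ≤ r < π`,
`c_i ≥ 0`, `Σ c_i ≤ 1`). [folklore] -/
theorem defect_sum_smul_le {A : ι → E →ₗ[ℂ] E} (hA : ∀ i, IsSkew (A i)) {r : ℝ} (hr : ∀ i, IsBdd (A i) r)
    (hr0 : 0 ≤ r) (hrπ : r < Real.pi) (c : ι → ℝ) (hc : ∀ i, 0 ≤ c i) (hcs : ∑ i, c i ≤ 1) (x : E) :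
    defect (∑ i, ((c i : ℝ) : ℂ) • A i) x ≤ ∑ i, c i * defect (A i) x := by
  have hA₀s : IsSkew (∑ i, ((c i : ℝ) : ℂ) • A i) := isSkew_sum_smul hA c
  have hA₀b : IsBdd (∑ i, ((c i : ℝ) : ℂ) • A i) r := isBdd_sum_smul hr hr0 c hc hcs
  have hl := hasSum_defect hA₀s hA₀b hr0 hrπ x
  have hr' : HasSum (fun n => ∑ i, c i * term (A i) x n) (∑ i, c i * defect (A i) x) :=
    hasSum_sum fun i _ => (hasSum_defect (hA i) (hr i) hr0 hrπ x).mul_left (c i)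
  refine hasSum_le (fun n => ?_) hl hr'
  unfold term
  have := rq_sum_smul_le hA hr hr0 (lt_succ_mul_pi hrπ n) c hc hcs x
  calc 2 * rq (((n : ℝ) + 1) * Real.pi) (∑ i, ((c i : ℝ) : ℂ) • A i) x ≤ 2 * ∑ i, c i * rq (((n : ℝ) + 1) * Real.pi) (A i) x := by
        linarith
    _ = ∑ i, c i * (2 * rq (((n : ℝ) + 1) * Real.pi) (A i) x) := by
        rw [Finset.mul_sum]; refine Finset.sum_congr rfl fun i _ => by ring

end Jensen


/-! ## 5. Evaluation in an orthonormal eigenbasis of `A` -/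

section Eigen

variable {ι' : Type*} [Fintype ι'] {A : E →ₗ[ℂ] E} {μ : ι' → ℝ}

omit [FiniteDimensional ℂ E] in
/-- The eigenvalue moduli are below the bound: `|μ_α| ≤ r`. [folklore] -/
theorem abs_eig_le (b : OrthonormalBasis ι' ℂ E) (hb : ∀ a, A (b a) = (((μ a : ℝ) : ℂ) * Complex.I) • b a) {r : ℝ}
    (hr : IsBdd A r) (a : ι') : |μ a| ≤ r := by
  have h := hr (b a)
  rw [hb a, norm_smul, b.orthonormal.1 a, mul_one, mul_one, norm_mul, Complex.norm_real, Complex.norm_I,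
    mul_one, Real.norm_eq_abs] at h
  exact h

omit [FiniteDimensional ℂ E] in
/-- `A x` in the eigenbasis: `A x = Σ_α (⟪b_α, x⟫ · iμ_α) b_α`. [folklore] -/
theorem apply_eq_sum_eigen (b : OrthonormalBasis ι' ℂ E) (hb : ∀ a, A (b a) = (((μ a : ℝ) : ℂ) * Complex.I) • b a)
    (x : E) : A x = ∑ a, (⟪b a, x⟫ * (((μ a : ℝ) : ℂ) * Complex.I)) • b a := by
  conv_lhs => rw [← b.sum_repr' x]
  simp only [map_sum, map_smul, hb, smul_smul]

omit [FiniteDimensional ℂ E] in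
/-- `P_ρ(A) b_α = (ρ² − μ_α²) b_α`. [folklore] -/
theorem P_apply_eigen (b : OrthonormalBasis ι' ℂ E) (hb : ∀ a, A (b a) = (((μ a : ℝ) : ℂ) * Complex.I) • b a)
    (ρ : ℝ) (a : ι') : P ρ A (b a) = (((ρ ^ 2 - μ a ^ 2 : ℝ) : ℂ)) • b a := by
  rw [P_apply, hb a, map_smul, hb a, smul_smul, ← add_smul]
  congr 1
  have hI : Complex.I * Complex.I = -1 := Complex.I_mul_I
  push_cast
  linear_combination ((μ a : ℂ)) ^ 2 * hI

/-- THE SOLUTION in the eigenbasis: `rsol (A x) = Σ_α (⟪b_α, x⟫ iμ_α/(ρ² − μ_α²)) b_α` (`|μ_α| ≤ r < ρ`). [folklore] -/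
theorem rsol_eq_sum_eigen (hA : IsSkew A) {r ρ : ℝ} (hr : IsBdd A r) (hr0 : 0 ≤ r) (hrρ : r < ρ)
    (b : OrthonormalBasis ι' ℂ E) (hb : ∀ a, A (b a) = (((μ a : ℝ) : ℂ) * Complex.I) • b a) (x : E) :
    rsol ρ A (A x) = ∑ a, (⟪b a, x⟫ * (((μ a : ℝ) : ℂ) * Complex.I) / (((ρ ^ 2 - μ a ^ 2 : ℝ) : ℂ))) • b a := by
  refine rsol_eq_of_P_eq (P_injective hA hr hr0 hrρ) ?_
  rw [map_sum, apply_eq_sum_eigen b hb x]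
  refine Finset.sum_congr rfl fun a _ => ?_
  have hd : ((ρ ^ 2 - μ a ^ 2 : ℝ) : ℂ) ≠ 0 := by
    have h1 := abs_eig_le b hb hr a
    have : μ a ^ 2 ≤ r ^ 2 := by
      have := abs_le.1 h1
      nlinarith
    have : 0 < ρ ^ 2 - μ a ^ 2 := by nlinarith
    exact_mod_cast this.ne'
  rw [map_smul, P_apply_eigen b hb ρ a, smul_smul, div_mul_cancel₀ _ hd]

/-- EIGEN-EVALUATION of the resolvent form: `rq_ρ(A, x) = Σ_α |⟪b_α, x⟫|² μ_α²/(ρ² − μ_α²)`. [folklore] -/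
theorem rq_eq_sum_eigen (hA : IsSkew A) {r ρ : ℝ} (hr : IsBdd A r) (hr0 : 0 ≤ r) (hrρ : r < ρ)
    (b : OrthonormalBasis ι' ℂ E) (hb : ∀ a, A (b a) = (((μ a : ℝ) : ℂ) * Complex.I) • b a) (x : E) :
    rq ρ A x = ∑ a, ‖⟪b a, x⟫‖ ^ 2 * (μ a ^ 2 / (ρ ^ 2 - μ a ^ 2)) := by
  unfold rq
  rw [rsol_eq_sum_eigen hA hr hr0 hrρ b hb x, apply_eq_sum_eigen b hb x, b.orthonormal.inner_sum, Complex.re_sum]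
  refine Finset.sum_congr rfl fun a _ => ?_
  set ξ : ℂ := ⟪b a, x⟫ with hξ
  set m : ℂ := ((μ a : ℝ) : ℂ) with hm
  set d : ℂ := ((ρ ^ 2 - μ a ^ 2 : ℝ) : ℂ) with hd
  have hn : conj ξ * ξ = ((‖ξ‖ ^ 2 : ℝ) : ℂ) := by
    rw [← Complex.normSq_eq_conj_mul_self, Complex.normSq_eq_norm_sq]
  have hI : Complex.I * Complex.I = -1 := Complex.I_mul_I
  have hkey : conj (ξ * (m * Complex.I)) * (ξ * (m * Complex.I) / d) =
      ((‖ξ‖ ^ 2 * (μ a ^ 2 / (ρ ^ 2 - μ a ^ 2)) : ℝ) : ℂ) := by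
    rw [map_mul, map_mul, hm, Complex.conj_ofReal, Complex.conj_I]
    calc conj ξ * (((μ a : ℝ) : ℂ) * -Complex.I) * (ξ * (((μ a : ℝ) : ℂ) * Complex.I) / d)
        = (conj ξ * ξ) * (-(Complex.I * Complex.I)) * ((((μ a : ℝ) : ℂ)) ^ 2 / d) := by ring
      _ = _ := by rw [hn, hI, neg_neg, mul_one, hd]; push_cast; ring
  rw [hkey, Complex.ofReal_re]

/-- `ψ` is even. [folklore] -/
theorem ψ_neg (θ : ℝ) : T4QuatExpLog.ψ (-θ) = T4QuatExpLog.ψ θ := by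
  simp [T4QuatExpLog.ψ, Real.cos_neg, Real.sinc_neg]

/-- Mittag-Leffler for `ψ` on the whole interval `|θ| < π` (from `T4EMLFibreAC.hasSum_ψ` on `0 < θ < π`, evenness, and
`ψ 0 = 0`). [folklore] -/
theorem hasSum_ψ_of_abs_lt {θ : ℝ} (h : |θ| < Real.pi) :
    HasSum (fun n : ℕ => 2 * θ ^ 2 / (((n : ℝ) + 1) ^ 2 * Real.pi ^ 2 - θ ^ 2)) (T4QuatExpLog.ψ θ) := by
  rcases lt_trichotomy θ 0 with hθ | hθ | hθ
  · have h' := T4EMLFibreAC.hasSum_ψ (neg_pos.2 hθ) (by rw [abs_of_neg hθ] at h; exact h)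
    rw [ψ_neg] at h'
    simpa only [neg_sq] using h'
  · subst hθ
    simp
  · exact T4EMLFibreAC.hasSum_ψ hθ (by rw [abs_of_pos hθ] at h; exact h)

/-- EIGEN-EVALUATION OF THE DEFECT FORM: `F(A, x) = Σ_α |⟪b_α, x⟫|² ψ(μ_α)`, `ψ(θ) = 1 − θ cot θ` (`A` skew, `r`-bounded,
`0 ≤ r < π`, `b` an orthonormal basis with `A b_α = iμ_α b_α`). [folklore] -/
theorem defect_eq_sum_eigen (hA : IsSkew A) {r : ℝ} (hr : IsBdd A r) (hr0 : 0 ≤ r) (hrπ : r < Real.pi)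
    (b : OrthonormalBasis ι' ℂ E) (hb : ∀ a, A (b a) = (((μ a : ℝ) : ℂ) * Complex.I) • b a) (x : E) :
    defect A x = ∑ a, ‖⟪b a, x⟫‖ ^ 2 * T4QuatExpLog.ψ (μ a) := by
  have hμ : ∀ a, |μ a| < Real.pi := fun a => (abs_eig_le b hb hr a).trans_lt hrπ
  have h1 : HasSum (fun n : ℕ => ∑ a, ‖⟪b a, x⟫‖ ^ 2 * (2 * μ a ^ 2 / (((n : ℝ) + 1) ^ 2 * Real.pi ^ 2 - μ a ^ 2)))
      (∑ a, ‖⟪b a, x⟫‖ ^ 2 * T4QuatExpLog.ψ (μ a)) :=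
    hasSum_sum fun a _ => (hasSum_ψ_of_abs_lt (hμ a)).mul_left _
  have h2 : term A x = fun n : ℕ => ∑ a, ‖⟪b a, x⟫‖ ^ 2 * (2 * μ a ^ 2 / (((n : ℝ) + 1) ^ 2 * Real.pi ^ 2 - μ a ^ 2)) := by
    funext n
    unfold term
    rw [rq_eq_sum_eigen hA hr hr0 (lt_succ_mul_pi hrπ n) b hb x, Finset.mul_sum]
    refine Finset.sum_congr rfl fun a _ => ?_
    rw [mul_pow]; ring
  exact (hasSum_defect hA hr hr0 hrπ x).unique (h2 ▸ h1)

omit [FiniteDimensional ℂ E] in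
/-- For skew `A`, the operator `−i·A` is symmetric. [folklore] -/
theorem isSymmetric_negI_smul (hA : IsSkew A) : ((-Complex.I) • A).IsSymmetric := by
  intro u v
  rw [LinearMap.smul_apply, LinearMap.smul_apply, inner_smul_left, inner_smul_right, hA u v, Complex.conj_neg_I]
  ring

/-- SPECTRAL THEOREM FOR SKEW `A` (convenience): an orthonormal eigenbasis with purely imaginary eigenvalues `iμ_α`, from
Mathlib's `LinearMap.IsSymmetric.eigenvectorBasis` for `−i·A`. [folklore] -/
theorem exists_orthonormalBasis_eigen (hA : IsSkew A) :
    ∃ (b : OrthonormalBasis (Fin (Module.finrank ℂ E)) ℂ E) (μ : Fin (Module.finrank ℂ E) → ℝ),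
      ∀ a, A (b a) = (((μ a : ℝ) : ℂ) * Complex.I) • b a := by
  have hT := isSymmetric_negI_smul hA
  refine ⟨hT.eigenvectorBasis rfl, hT.eigenvalues rfl, fun a => ?_⟩
  have h := hT.apply_eigenvectorBasis rfl a
  rw [LinearMap.smul_apply] at h
  -- `A v = i · ((−i) A v) = i · (μ v)`
  have h2 : A (hT.eigenvectorBasis rfl a) = Complex.I • ((-Complex.I) • A (hT.eigenvectorBasis rfl a)) := by
    rw [smul_smul]; simp
  rw [h2, h, smul_smul, mul_comm]
  rfl

omit [FiniteDimensional ℂ E] in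
/-- DIAGONAL PAIRING: if the `b`-coordinates of `H` are `m_α ⟪b_α, x⟫`, then `Re⟪x, H⟫ = Σ_α |⟪b_α, x⟫|² Re m_α`.
[folklore] -/
theorem re_inner_of_diag_coords (b : OrthonormalBasis ι' ℂ E) (m : ι' → ℂ) (x H : E)
    (hH : ∀ a, ⟪b a, H⟫ = m a * ⟪b a, x⟫) : (⟪x, H⟫).re = ∑ a, ‖⟪b a, x⟫‖ ^ 2 * (m a).re := by
  rw [← b.sum_inner_mul_inner x H, Complex.re_sum]
  refine Finset.sum_congr rfl fun a _ => ?_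
  rw [hH a, ← inner_conj_symm x (b a)]
  set ξ : ℂ := ⟪b a, x⟫
  have hn : conj ξ * ξ = ((‖ξ‖ ^ 2 : ℝ) : ℂ) := by
    rw [← Complex.normSq_eq_conj_mul_self, Complex.normSq_eq_norm_sq]
  calc (conj ξ * (m a * ξ)).re = (((‖ξ‖ ^ 2 : ℝ) : ℂ) * m a).re := by rw [← hn]; ring_nf
    _ = ‖ξ‖ ^ 2 * (m a).re := by rw [Complex.re_ofReal_mul]

/-- THE KEY-IDENTITY SHAPE: if the `b`-coordinates of `H` are `m_α ⟪b_α, x⟫` with `Re m_α = 1 − ψ(μ_α)` (`b` an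
eigenbasis of the skew `r`-bounded `A`, `A b_α = iμ_α b_α`, `0 ≤ r < π`), then `Re⟪x, H⟫ = ‖x‖² − F(A, x)`. [folklore] -/
theorem re_inner_eq_norm_sq_sub_defect (hA : IsSkew A) {r : ℝ} (hr : IsBdd A r) (hr0 : 0 ≤ r) (hrπ : r < Real.pi)
    (b : OrthonormalBasis ι' ℂ E) (hb : ∀ a, A (b a) = (((μ a : ℝ) : ℂ) * Complex.I) • b a) (m : ι' → ℂ)
    (hm : ∀ a, (m a).re = 1 - T4QuatExpLog.ψ (μ a)) (x H : E) (hH : ∀ a, ⟪b a, H⟫ = m a * ⟪b a, x⟫) :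
    (⟪x, H⟫).re = ‖x‖ ^ 2 - defect A x := by
  rw [re_inner_of_diag_coords b m x H hH, defect_eq_sum_eigen hA hr hr0 hrπ b hb x, ← b.sum_sq_norm_inner_right x,
    ← Finset.sum_sub_distrib]
  refine Finset.sum_congr rfl fun a _ => ?_
  rw [hm a]; ring

end Eigen

/-! ## 6. The endgame: pairing the kernel equation with `x` -/

section Endgame

variable {ι : Type*} [Fintype ι]

/-- THE ENDGAME OF THE TANGENT-INJECTIVITY ARGUMENT.  `A_i` skew and `r`-bounded (`0 ≤ r < π`), `c_i ≥ 0` with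
`Σ c_i < 1`, `A₀ = Σ c_i A_i`; if vectors `H_i`, `H₀` satisfy `Re⟪x, H_i⟫ = ‖x‖² − F(A_i, x)`, `Re⟪x, H₀⟫ = ‖x‖² − F(A₀, x)`
(the KEY IDENTITY, e.g. via `re_inner_eq_norm_sq_sub_defect`) and the kernel equation `Σ c_i H_i = H₀`, then `x = 0`:
pairing gives `(1 − Σ c_i)‖x‖² = F(A₀, x) − Σ c_i F(A_i, x) ≤ 0` by Jensen with slack. [folklore] -/
theorem eq_zero_of_kernel_equation {A : ι → E →ₗ[ℂ] E} (hA : ∀ i, IsSkew (A i)) {r : ℝ} (hr : ∀ i, IsBdd (A i) r)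
    (hr0 : 0 ≤ r) (hrπ : r < Real.pi) (c : ι → ℝ) (hc : ∀ i, 0 ≤ c i) (hcs : ∑ i, c i < 1) (x : E) (H : ι → E)
    (H₀ : E) (hHi : ∀ i, (⟪x, H i⟫).re = ‖x‖ ^ 2 - defect (A i) x)
    (hH₀ : (⟪x, H₀⟫).re = ‖x‖ ^ 2 - defect (∑ i, ((c i : ℝ) : ℂ) • A i) x)
    (hE : ∑ i, ((c i : ℝ) : ℂ) • H i = H₀) : x = 0 := by
  have hJ := defect_sum_smul_le hA hr hr0 hrπ c hc hcs.le x
  -- pair the kernel equation with `x`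
  have hpair : ∑ i, c i * (‖x‖ ^ 2 - defect (A i) x) = ‖x‖ ^ 2 - defect (∑ i, ((c i : ℝ) : ℂ) • A i) x := by
    rw [← hH₀, ← hE, inner_sum, Complex.re_sum]
    refine Finset.sum_congr rfl fun i _ => ?_
    rw [inner_smul_right, Complex.re_ofReal_mul, hHi i]
  -- `(1 − s)‖x‖² = F₀ − Σ c_i F_i ≤ 0`
  have hkey : (1 - ∑ i, c i) * ‖x‖ ^ 2 = defect (∑ i, ((c i : ℝ) : ℂ) • A i) x - ∑ i, c i * defect (A i) x := by
    have : ∑ i, c i * (‖x‖ ^ 2 - defect (A i) x) = (∑ i, c i) * ‖x‖ ^ 2 - ∑ i, c i * defect (A i) x := by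
      rw [Finset.sum_mul, ← Finset.sum_sub_distrib]
      refine Finset.sum_congr rfl fun i _ => by ring
    linarith [hpair, this]
  have h1 : (1 - ∑ i, c i) * ‖x‖ ^ 2 ≤ 0 := by linarith
  have h2 : 0 < 1 - ∑ i, c i := by linarith
  have h3 : ‖x‖ ^ 2 ≤ 0 := by
    by_contra h
    push Not at h
    linarith [mul_pos h2 h]
  have : ‖x‖ = 0 := by nlinarith [norm_nonneg x]
  exact norm_eq_zero.1 this

end Endgame


end Literature.MathematicalPhysics.QuantumFieldTheory.Balaban1983to89.T4AdResolventConvex
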